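import Literature.MathematicalPhysics.QuantumFieldTheory.Balaban1983to89.B3Ineq211RegularTorus

/-!
# Bałaban, *(Higgs)₂,₃ quantum fields in a finite volume III. Renormalization* [B3] — (2.10) p. 426, THE CLAUSE *"for each
differentiation, there is an additional factor (L^jη)^{−1}"* WITH ONE COVARIANT DIFFERENTIATION IN EACH VARIABLE (the kernels
`(D^η_{B̃,μ}G^η_{(j)}D^{η*}_{B̃,ν})(x,x′)`), AT A REGULAR NON-CONSTANT BACKGROUND `B̃ = A` ON THE TORUS `Ω = T_η`, PROVED for the pieces
`G^η_{(j)}(T_η, A)` of r14's `B3Ineq210RegularTorus` (`pieceA`), uniformly in the volume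

statement-level skeleton of published theorems with citation tags; proofs where landed; nothing here is a claim about the Yang–Mills mass gap

T. Bałaban, Commun. Math. Phys. **88** (1983) 411–445 [cite: Balaban1983Higgs3]; inputs from part I, Commun. Math. Phys. **85** (1982)
603–636 [cite: Balaban1982Higgs1] as landed in the tree.  PDF held: `paper:balaban1983-higgs-2-3-quantum-fields-finite-volume` (journal page =
PDF page + 410), p. 426 [PDF 16] (`p0016.txt`), p. 432 [PDF 22] (`p0022.txt`).

CITATION HEADER (lean-in-tree rule).  Cell `lit-balaban` (HOME `run/shared/lean/pub/lit-balaban/`), Phase-2 proof seat **p40** gen 68 (unit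
`lit-balaban-p40`); SKELETON row **B3.Eq2.10** (fold owner r15; decl of record `B3Sect2StatementsPart2.ScaledKernels.Ineq210` — whose two
displayed members, value and ONE derivative, are r14's `B3Ineq210RegularTorus.ineq210_regularTorus`; the twice-differentiated member is the
clause of the same sentence used by §3 of [B3] and by (3.1)).  REGULAR-BACKGROUND TWIN of p20's `B3Ineq210MixedTorus` (p260636: the same
clause at `A = B̃ = 0`, plain second differences `∂_μG∂_νᵀ`); file 1 of 2 of the member «(3.1) at a regular non-constant background on `T_η`»
(file 2, `B3Ineq31RegularTorus`, assembles the two-variable norm (1.32)).  USED BY NAME, never restated: r14 p339501's pieces `pieceA`/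
`sandwich`/`termA` and engine (`norm_covDeriv_G_avgQkAdj_cb_le`, `mat_QG_eq`, `sum3_le`, `exp_blockIter_le`, `norm_covDeriv_apply_le_sum_coord`,
`reg223_of_small`, `aSeq_sq_le`, `card_Ix`), p35's Proposition I.2.1 (2.25) derivative clause at a regular `A` on the torus
`B1Ineq225RegularTorus.norm_covDeriv_propagatorK_reg_decay`, r14's (I.2.34) `B1Props21to23RegularTorus.ineq234_236_regular_torus_std`, p35's
`B1TorusChainTransport.U_apply_sub_eq_smul_covDeriv`, the symmetry `B1Eq230FluctCovPos.siteInner_propagatorK_comm`, the typer's `HiggsLattice`.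

## What is printed (p. 426 [PDF 16], verbatim)

*"For the propagators G^η_{(j)} we apply the inequality |G^η_{(j)}(Ω, B̃; x, x′)| ≤ O(1)(L^jη)^{−d+2}e^{−δ₁(L^jη)^{−1}|x−x′|}, (2.10) and if
the propagator is differentiated, then for each differentiation, there is an additional factor (L^jη)^{−1} on the right side. … They all
are obtained by rescaling from the η-lattice to the L^{−j}-lattice and application of Propositions I.2.1 and I.2.3."*  Two covariant
differentiations — `D^η_{B̃,μ}` in `x` from the left, the adjoint `D^{η*}_{B̃,ν}` in `x′` from the right — give the degree `−d`.

## What this file proves (`ineq210_mixed_regularTorus`), and how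

`ε^{−d}Σ_i‖(D^ε_{A,μ}G^η_{(j)}D^{ε*}_{A,ν})(x, x′)e_i‖ ≤ C(L^jη)^{−d}e^{−δ₁(L^jη)^{−1}|x−x′|}` for every piece `j`, all bonds `⟨x,μ⟩`, `⟨x′,ν⟩`
of `T_ε`, at a `δ_A`-regular non-constant background with the smallness `L^k·δ_A·|e| ≤ t(K₀)` — same hypotheses and constants-shape as
r14's (2.10) and p26's (2.11).  The right derivative is realised by the DIPOLE SOURCE `dip ⟨x′,ν⟩ w = δ_{x′+εe_ν}·U(A_{⟨x′,ν⟩})^*w − δ_{x′}·w =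
ε·D^{ε*}_A(δ_{⟨x′,ν⟩}w)` (`sum_inner_dip`: `Σ_y⟨dip_c w(y), f(y)⟩ = ε⟨w, (D^ε_Af)(c)⟩`), so that `(D^ε_AG^η_{(j)}(dip_c w))(b) =
ε·(D^ε_AG^η_{(j)}D^{ε*}_A)(b,c)w` (`mixedTerm`).  Route = the print's: in each term `a_j²(L^jε)^{−4}G^ε_jQ_j^*C^{(j)}Q_jG^ε_j` of (I.2.43) the
two derivatives fall on the two OUTER factors `G^ε_j(T_ε, A)`: on the left by Proposition I.2.1 (2.25) (derivative member) directly, on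
the right by the same clause after the adjointness `(Q_jG^ε_j)^* = G^ε_jQ_j^*` for the products (I.1.5) (`abs_coord_QG_dip_le`: the
coordinates of `Q_jG^ε_j(dip_c w)` ARE `L^{−jd}ε⟨w, D^ε_A(G^ε_jQ_j^*e_t)(c)⟩`); the middle factor by (I.2.34); the three-kernel convolution on
`T^{(j)}` (`sum3_le`); the scaling `ε^{−d}·ε^{−1}·a_j²(L^jε)^{−4}(L^jε)^{1+2+1}L^{−jd}·ε = a_j²(L^jε)^{−d}`; the piece `G^η_{(0)} = G^ε_1` is (2.25)
at level `1` with the dipole source.  §0 one-site sources and the dipole, the adjoint identities (incl. the symmetry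
`⟨w, G^ε_k(x,x′)v⟩ = ⟨G^ε_k(x′,x)w, v⟩` and `⟨w, (D^ε_AG^ε_k δ_{x′}v)(b)⟩ = ε^{−1}⟨(G^ε_k dip_b w)(x′), v⟩` used by file 2); §1 the engine;
§2 the pieces; §3 the constant and the theorem.

## Honest scope

As r14/p26: `Ω = T_η` only (no region, no `∂Ω`); `m² > 0`; the `Shape` sub-family (`L` odd `> 1`) tiled by `K₀`-cubes (`K₀ ∣ M`,
`3K₀ ≤ 2M`, `K₀ ≥ K₀,min`); constants depend on `K₀` as in the cited inputs; `|·|` of an `N × N` block = the column sum over an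
orthonormal basis `e_i` of the Euclidean norms.  No `def … : Prop`, no new named fact (`dip`, `mixedTerm`, `cstMix` are concrete `def`s);
axioms standard.  Value = kernel certificate of a located by-reference step of B3 at a regular background, NOT summit progress.
-/

noncomputable section

open scoped BigOperators InnerProductSpace Matrix

namespace Literature.MathematicalPhysics.QuantumFieldTheory.Balaban1983to89.B3Ineq210MixedRegularTorus

open HiggsLattice (ChargeData ScalarField siteInner covDeriv)
open HiggsCovariance (propagatorK avgQkLin avgQkAdj E)
open HiggsAveraging (blockIter)
open HiggsFluctMeasure (coeff221)
open B1Eq221Coordinates (fieldCoord fieldCoord_apply siteCoord_apply sum_inner_eq_dotProduct)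
open B1Eq230FluctCov (mat Ix cb fluctCovA cb_repr mat_mulVec)
open B1Eq230FluctCovPos (siteInner_propagatorK_comm)
open B1Ineq234Concrete (profile profile_nonneg' nCol fieldCoord_cb)
open B1Ineq227BackgroundTorus (abs_fieldCoord_le)
open B1Ineq234LevelZero (tdist_comm tdist_triangle_real tdist_shift_le_one)
open B1TorusChainTransport (U_apply_sub_eq_smul_covDeriv)
open B2Restr216Lattice (norm_U_apply)
open B1Eq211ZeroFieldTorus (Shape)
open B3Ineq210RegularTorus

variable {P : HiggsLattice.Params} {N : ℕ}

/-! ## §0 One-site sources, the dipole source of the right covariant derivative, adjoint identities -/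

section Algebra

/-- The orthonormal basis `e_i` of `ℝ^N` underlying the coordinate dictionary (`B1Eq221Coordinates`: Mathlib's `stdOrthonormalBasis`).
[cite: Balaban1982Higgs1, (1.5) p.604] -/
def onb (N : ℕ) (i : Ix N) : E N := stdOrthonormalBasis ℝ (E N) i

/-- `‖e_i‖ = 1`. [cite: Balaban1982Higgs1, (1.5) p.604] -/
theorem norm_onb (i : Ix N) : ‖onb N i‖ = 1 := (stdOrthonormalBasis ℝ (E N)).orthonormal.1 i

/-- The coordinates of a one-site field: `(δ_{x′}v)_{(y,i)} = δ_{y,x′}⟨e_i, v⟩`. [cite: Balaban1982Higgs1, (1.5) p.604] -/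
theorem fieldCoord_single {k : ℕ} (x' : HiggsLattice.Site P k) (v : E N) (s : HiggsLattice.Site P k × Ix N) :
    fieldCoord (E N) (HiggsLattice.Site P k) (Pi.single x' v : ScalarField P k N) s
      = if s.1 = x' then (stdOrthonormalBasis ℝ (E N)).repr v s.2 else 0 := by
  rw [fieldCoord_apply, siteCoord_apply]
  by_cases h : s.1 = x'
  · rw [if_pos h, h, Pi.single_eq_same]
  · rw [if_neg h, Pi.single_eq_of_ne h, map_zero]
    rfl

/-- `|(δ_{x′}v)_s| ≤ ‖v‖`. [cite: Balaban1982Higgs1, (1.5) p.604] -/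
theorem abs_fieldCoord_single_le {k : ℕ} (x' : HiggsLattice.Site P k) (v : E N) (s : HiggsLattice.Site P k × Ix N) :
    |fieldCoord (E N) (HiggsLattice.Site P k) (Pi.single x' v : ScalarField P k N) s| ≤ ‖v‖ := by
  refine (abs_fieldCoord_le _ s.1 s.2).trans ?_
  by_cases h : s.1 = x'
  · rw [h, Pi.single_eq_same]
  · rw [Pi.single_eq_of_ne h, norm_zero]; exact norm_nonneg _

/-- `(δ_{x′}v)_s = 0` off the site `x′`. [cite: Balaban1982Higgs1, (1.5) p.604] -/
theorem fieldCoord_single_of_ne {k : ℕ} (x' : HiggsLattice.Site P k) (v : E N) {s : HiggsLattice.Site P k × Ix N} (h : s.1 ≠ x') :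
    fieldCoord (E N) (HiggsLattice.Site P k) (Pi.single x' v : ScalarField P k N) s = 0 := by
  rw [fieldCoord_single, if_neg h]

/-- The basis field `e_{(x′,i′)}` IS the one-site field `δ_{x′}e_{i′}`. [cite: Balaban1982Higgs1, (1.5) p.604] -/
theorem cb_eq_single {k : ℕ} (x' : HiggsLattice.Site P k) (i' : Ix N) :
    cb P N k (x', i') = (Pi.single x' (onb N i') : ScalarField P k N) := by
  apply (fieldCoord (E N) (HiggsLattice.Site P k)).injective
  rw [fieldCoord_cb]
  funext s
  rw [fieldCoord_single]
  unfold onb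
  rw [OrthonormalBasis.repr_self, PiLp.single_apply]
  obtain ⟨y, i⟩ := s
  simp only [Pi.single_apply, Prod.mk.injEq]
  by_cases h : y = x' <;> by_cases hi : i = i' <;> simp [h, hi]

/-- **A linear map on a one-site source, through the basis fields**: `‖(f δ_{x′}v)(y)‖ ≤ ‖v‖·Σ_{i′}‖(f e_{(x′,i′)})(y)‖`.
[cite: Balaban1982Higgs1, (1.5) p.604] -/
theorem norm_apply_single_le {i j : ℕ} (f : ScalarField P i N →ₗ[ℝ] ScalarField P j N) (x' : HiggsLattice.Site P i) (v : E N)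
    (y : HiggsLattice.Site P j) :
    ‖f (Pi.single x' v) y‖ ≤ ‖v‖ * ∑ i' : Ix N, ‖f (cb P N i (x', i')) y‖ := by
  refine (norm_apply_le_sum_coord f _ y).trans ?_
  rw [Fintype.sum_prod_type, Finset.sum_eq_single x', Finset.mul_sum]
  · exact Finset.sum_le_sum fun i' _ => mul_le_mul_of_nonneg_right (abs_fieldCoord_single_le x' v _) (norm_nonneg _)
  · intro x _ hx
    exact Finset.sum_eq_zero fun i' _ => by rw [fieldCoord_single_of_ne x' v (s := (x, i')) hx, abs_zero, zero_mul]
  · intro h; exact absurd (Finset.mem_univ x') h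

/-- The same for the covariant derivative: `‖(D^ε_A(f δ_{x′}v))(b)‖ ≤ ‖v‖·Σ_{i′}‖(D^ε_A(f e_{(x′,i′)}))(b)‖`.
[cite: Balaban1982Higgs1, (1.5) p.604, (1.7) p.605] -/
theorem norm_covDeriv_apply_single_le {i : ℕ} (C : ChargeData N) (A : HiggsLattice.VecField P 0)
    (f : ScalarField P i N →ₗ[ℝ] ScalarField P 0 N) (x' : HiggsLattice.Site P i) (v : E N) (b : HiggsLattice.PBond P 0) :
    ‖covDeriv C A (f (Pi.single x' v)) b‖ ≤ ‖v‖ * ∑ i' : Ix N, ‖covDeriv C A (f (cb P N i (x', i'))) b‖ := by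
  refine (norm_covDeriv_apply_le_sum_coord C A f _ b).trans ?_
  rw [Fintype.sum_prod_type, Finset.sum_eq_single x', Finset.mul_sum]
  · exact Finset.sum_le_sum fun i' _ => mul_le_mul_of_nonneg_right (abs_fieldCoord_single_le x' v _) (norm_nonneg _)
  · intro x _ hx
    exact Finset.sum_eq_zero fun i' _ => by rw [fieldCoord_single_of_ne x' v (s := (x, i')) hx, abs_zero, zero_mul]
  · intro h; exact absurd (Finset.mem_univ x') h

/-- `Σ_y⟨δ_a u(y), f(y)⟩ = ⟨u, f(a)⟩`. [cite: Balaban1982Higgs1, (1.5) p.604] -/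
theorem sum_inner_single_left {k : ℕ} (a : HiggsLattice.Site P k) (u : E N) (f : ScalarField P k N) :
    ∑ y : HiggsLattice.Site P k, ⟪(Pi.single a u : ScalarField P k N) y, f y⟫_ℝ = ⟪u, f a⟫_ℝ := by
  rw [Finset.sum_eq_single a]
  · rw [Pi.single_eq_same]
  · intro y _ hy; rw [Pi.single_eq_of_ne hy, inner_zero_left]
  · intro h; exact absurd (Finset.mem_univ a) h

/-- `⟨f, δ_a u⟩_{T} = η^d⟨f(a), u⟩` for the product (1.5). [cite: Balaban1982Higgs1, (1.5) p.604] -/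
theorem siteInner_single_right {k : ℕ} (f : ScalarField P k N) (a : HiggsLattice.Site P k) (u : E N) :
    siteInner f (Pi.single a u : ScalarField P k N) = P.mesh k ^ P.d * ⟪f a, u⟫_ℝ := by
  unfold siteInner
  rw [← Finset.mul_sum, Finset.sum_eq_single a]
  · rw [Pi.single_eq_same]
  · intro y _ hy; rw [Pi.single_eq_of_ne hy, inner_zero_right]
  · intro h; exact absurd (Finset.mem_univ a) h

/-- `U(−a)` is the adjoint of `U(a)`: `⟨U(−a)w, y⟩ = ⟨w, U(a)y⟩` (*"Antisymmetry of q implies U(A)* = U(−A)"*).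
[cite: Balaban1982Higgs1, (1.7) p.605] -/
theorem inner_U_neg_left (C : ChargeData N) (η a : ℝ) (w y : E N) : ⟪C.U η (-a) w, y⟫_ℝ = ⟪w, C.U η a y⟫_ℝ := by
  rw [← ChargeData.star_U, ContinuousLinearMap.star_eq_adjoint, ContinuousLinearMap.adjoint_inner_left]

variable (C : ChargeData N) (A : HiggsLattice.VecField P 0)

/-- **The dipole source across the bond `c = ⟨x′, x′ + εe_ν⟩` carrying `w ∈ ℝ^N`**: `dip_c w = δ_{c₊}·U(A_c)^*w − δ_{c₋}·w` — `ε` times the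
adjoint covariant derivative `D^{ε*}_A` (for the products (I.1.5) on sites and bonds) of the bond delta `δ_c w` (`sum_inner_dip`).
[cite: Balaban1982Higgs1, (1.7) p.605] -/
def dip (c : HiggsLattice.PBond P 0) (w : E N) : ScalarField P 0 N :=
  Pi.single c.tgt (C.U (P.mesh 0) (-(A c)) w) - Pi.single c.src w

variable {C A}

/-- `‖dip_c w(y)‖ ≤ 2‖w‖` (`U` is an isometry). [cite: Balaban1982Higgs1, (1.7) p.605] -/
theorem norm_dip_le (c : HiggsLattice.PBond P 0) (w : E N) (y : HiggsLattice.Site P 0) : ‖dip C A c w y‖ ≤ 2 * ‖w‖ := by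
  unfold dip
  rw [Pi.sub_apply]
  refine (norm_sub_le _ _).trans ?_
  have h1 : ‖(Pi.single c.tgt (C.U (P.mesh 0) (-(A c)) w) : ScalarField P 0 N) y‖ ≤ ‖w‖ := by
    by_cases h : y = c.tgt
    · rw [h, Pi.single_eq_same, norm_U_apply]
    · rw [Pi.single_eq_of_ne h, norm_zero]; exact norm_nonneg _
  have h2 : ‖(Pi.single c.src w : ScalarField P 0 N) y‖ ≤ ‖w‖ := by
    by_cases h : y = c.src
    · rw [h, Pi.single_eq_same]
    · rw [Pi.single_eq_of_ne h, norm_zero]; exact norm_nonneg _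
  linarith

/-- `dip_c w` is supported on the two ends of `c`. [cite: Balaban1982Higgs1, (1.7) p.605] -/
theorem dip_eq_zero_of_ne (c : HiggsLattice.PBond P 0) (w : E N) {y : HiggsLattice.Site P 0} (h₁ : y ≠ c.src) (h₂ : y ≠ c.tgt) :
    dip C A c w y = 0 := by
  unfold dip
  rw [Pi.sub_apply, Pi.single_eq_of_ne h₂, Pi.single_eq_of_ne h₁, sub_zero]

/-- `dip_c` is additive in `w`. [cite: Balaban1982Higgs1, (1.7) p.605] -/
theorem dip_add (c : HiggsLattice.PBond P 0) (w w' : E N) : dip C A c (w + w') = dip C A c w + dip C A c w' := by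
  unfold dip
  rw [map_add, Pi.single_add, Pi.single_add]
  abel

/-- `dip_c` is homogeneous in `w`. [cite: Balaban1982Higgs1, (1.7) p.605] -/
theorem dip_smul (c : HiggsLattice.PBond P 0) (r : ℝ) (w : E N) : dip C A c (r • w) = r • dip C A c w := by
  unfold dip
  rw [map_smul, Pi.single_smul, Pi.single_smul, smul_sub]

/-- **The dipole identity**: `Σ_y⟨dip_c w(y), f(y)⟩ = ε·⟨w, (D^ε_Af)(c)⟩` for every field `f` — `dip_c w = ε·D^{ε*}_A(δ_c w)`.
[cite: Balaban1982Higgs1, (1.7) p.605] -/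
theorem sum_inner_dip (c : HiggsLattice.PBond P 0) (w : E N) (f : ScalarField P 0 N) :
    ∑ y : HiggsLattice.Site P 0, ⟪dip C A c w y, f y⟫_ℝ = P.mesh 0 * ⟪w, covDeriv C A f c⟫_ℝ := by
  unfold dip
  simp_rw [Pi.sub_apply, inner_sub_left, Finset.sum_sub_distrib, sum_inner_single_left, inner_U_neg_left]
  rw [← inner_sub_right, U_apply_sub_eq_smul_covDeriv, real_inner_smul_right]

/-- The dipole identity in coordinates: `(dip_c w)·(f) = ε⟨w, (D^ε_Af)(c)⟩` (dot product of the coordinate vectors).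
[cite: Balaban1982Higgs1, (1.5) p.604, (1.7) p.605] -/
theorem fieldCoord_dip_dotProduct (c : HiggsLattice.PBond P 0) (w : E N) (f : ScalarField P 0 N) :
    fieldCoord (E N) (HiggsLattice.Site P 0) (dip C A c w) ⬝ᵥ fieldCoord (E N) (HiggsLattice.Site P 0) f
      = P.mesh 0 * ⟪w, covDeriv C A f c⟫_ℝ := by
  rw [← sum_inner_eq_dotProduct, sum_inner_dip]

/-- `⟨dip_c w, f⟩_{T_ε} = ε^d·ε·⟨w, (D^ε_Af)(c)⟩`. [cite: Balaban1982Higgs1, (1.5) p.604, (1.7) p.605] -/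
theorem siteInner_dip (c : HiggsLattice.PBond P 0) (w : E N) (f : ScalarField P 0 N) :
    siteInner (dip C A c w) f = P.mesh 0 ^ P.d * (P.mesh 0 * ⟪w, covDeriv C A f c⟫_ℝ) := by
  unfold siteInner
  rw [← Finset.mul_sum, sum_inner_dip]

/-- `dip_c 0 = 0`. [cite: Balaban1982Higgs1, (1.7) p.605] -/
theorem dip_zero (c : HiggsLattice.PBond P 0) : dip C A c (0 : E N) = 0 := by
  unfold dip
  rw [map_zero, Pi.single_zero, Pi.single_zero, sub_zero]

/-- `dip_c` of a linear combination. [cite: Balaban1982Higgs1, (1.7) p.605] -/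
theorem dip_sum_smul {ι : Type*} (s : Finset ι) (r : ι → ℝ) (v : ι → E N) (c : HiggsLattice.PBond P 0) :
    dip C A c (∑ i ∈ s, r i • v i) = ∑ i ∈ s, r i • dip C A c (v i) := by
  classical
  induction s using Finset.induction_on with
  | empty => rw [Finset.sum_empty, Finset.sum_empty, dip_zero]
  | insert i s hi ih => rw [Finset.sum_insert hi, Finset.sum_insert hi, dip_add, dip_smul, ih]

/-- **Expansion of the covariant derivative of a dipole response in the basis of `ℝ^N`**: for a linear `f`,
`‖(D^ε_A f(dip_c w))(b)‖ ≤ ‖w‖·Σ_i‖(D^ε_A f(dip_c e_i))(b)‖`. [cite: Balaban1982Higgs1, (1.5) p.604, (1.7) p.605] -/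
theorem norm_covDeriv_dip_le_sum (f : ScalarField P 0 N →ₗ[ℝ] ScalarField P 0 N) (c b : HiggsLattice.PBond P 0) (w : E N) :
    ‖covDeriv C A (f (dip C A c w)) b‖ ≤ ‖w‖ * ∑ i : Ix N, ‖covDeriv C A (f (dip C A c (onb N i))) b‖ := by
  have hdip : dip C A c w = ∑ i : Ix N, (stdOrthonormalBasis ℝ (E N)).repr w i • dip C A c (onb N i) := by
    rw [← dip_sum_smul]
    unfold onb
    rw [(stdOrthonormalBasis ℝ (E N)).sum_repr w]
  rw [hdip, map_sum, covDeriv_sum'', Finset.mul_sum]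
  refine (norm_sum_le _ _).trans (Finset.sum_le_sum fun i _ => ?_)
  rw [map_smul, covDeriv_smul'', norm_smul, Real.norm_eq_abs]
  refine mul_le_mul_of_nonneg_right ?_ (norm_nonneg _)
  rw [← Real.norm_eq_abs, ← (stdOrthonormalBasis ℝ (E N)).repr.norm_map w]
  exact PiLp.norm_apply_le _ i

variable (C A) (msq a : ℝ)

/-- **Symmetry of the kernel of `G^ε_k(T_ε, A)`**: `⟨w, (G^ε_kδ_{x′}v)(x)⟩ = ⟨(G^ε_kδ_xw)(x′), v⟩` — the `N × N` blocks satisfy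
`G^ε_k(x,x′)^* = G^ε_k(x′,x)` (the operator is symmetric for (I.1.5), `B1Eq230FluctCovPos.siteInner_propagatorK_comm`).
[cite: Balaban1982Higgs1, (2.20) p.610] -/
theorem inner_propagatorK_single_comm (k : ℕ) (x x' : HiggsLattice.Site P 0) (v w : E N) :
    ⟪w, propagatorK C Finset.univ A msq a k (Pi.single x' v) x⟫_ℝ
      = ⟪propagatorK C Finset.univ A msq a k (Pi.single x w) x', v⟫_ℝ := by
  have h := siteInner_propagatorK_comm C Finset.univ A msq a k (Pi.single x w) (Pi.single x' v)
  rw [HiggsFluctMeasurePos.siteInner_comm (Pi.single x w : ScalarField P 0 N), siteInner_single_right,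
    HiggsFluctMeasurePos.siteInner_comm (Pi.single x' v : ScalarField P 0 N), siteInner_single_right, real_inner_comm] at h
  have hm : (0 : ℝ) < P.mesh 0 ^ P.d := pow_pos (P.mesh_pos 0) _
  exact mul_left_cancel₀ hm.ne' h

/-- **The adjoint identity of the row-differentiated block**: `⟨w, (D^ε_AG^ε_kδ_{x′}v)(b)⟩ = ε^{−1}⟨(G^ε_k dip_b w)(x′), v⟩` — the COLUMN
SLICE of the row-differentiated kernel, as a field of `x′`, is `ε^{−1}G^ε_k(dip_b w)` (dipole identity + symmetry).
[cite: Balaban1982Higgs1, (1.7) p.605, (2.20) p.610] -/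
theorem inner_covDeriv_propagatorK_single (k : ℕ) (b : HiggsLattice.PBond P 0) (x' : HiggsLattice.Site P 0) (v w : E N) :
    ⟪w, covDeriv C A (propagatorK C Finset.univ A msq a k (Pi.single x' v)) b⟫_ℝ
      = (P.mesh 0)⁻¹ * ⟪propagatorK C Finset.univ A msq a k (dip C A b w) x', v⟫_ℝ := by
  have hε : P.mesh 0 ≠ 0 := (P.mesh_pos 0).ne'
  have hm : (0 : ℝ) < P.mesh 0 ^ P.d := pow_pos (P.mesh_pos 0) _
  have h1 := siteInner_dip (C := C) (A := A) b w (propagatorK C Finset.univ A msq a k (Pi.single x' v))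
  rw [siteInner_propagatorK_comm C Finset.univ A msq a k, HiggsFluctMeasurePos.siteInner_comm, siteInner_single_right] at h1
  have h2 := mul_left_cancel₀ hm.ne' h1
  rw [h2, ← mul_assoc, inv_mul_cancel₀ hε, one_mul]

end Algebra

/-! ## §1 The engine: the covariant derivative of one sandwich `G^ε_lQ_l^*C^{(l)}Q_lG^ε_l` on a dipole source

At one level `1 ≤ l ≤ K` the inputs are taken as hypotheses in the shape the tree's theorems print them: `hDG` = the (I.2.25) derivative
clause with its decay factor (p35's `norm_covDeriv_propagatorK_reg_decay`) — used on BOTH outer factors — and `hC` = the (I.2.34) kernel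
bound of `C^{(l)}(T_ε, A)` (r14's `ineq234_236_regular_torus_std`). -/

section Engine

variable (C : ChargeData N) (A : HiggsLattice.VecField P 0) (msq a : ℝ) {l : ℕ}

/-- Coordinates through a kernel: `|(Mφ)_s| ≤ Σ_t |M(s,t)|·|φ_t|`. [cite: Balaban1982Higgs1, (1.5) p.604] -/
theorem abs_fieldCoord_apply_le {i j : ℕ} (M : ScalarField P i N →ₗ[ℝ] ScalarField P j N) (φ : ScalarField P i N)
    (s : HiggsLattice.Site P j × Ix N) :
    |fieldCoord (E N) (HiggsLattice.Site P j) (M φ) s|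
      ≤ ∑ t : HiggsLattice.Site P i × Ix N, |mat M s t| * |fieldCoord (E N) (HiggsLattice.Site P i) φ t| := by
  rw [← mat_mulVec, Matrix.mulVec, dotProduct]
  exact (Finset.abs_sum_le_sum_abs _ _).trans (le_of_eq (Finset.sum_congr rfl fun t _ => abs_mul _ _))

/-- **The third kernel on a dipole source, by adjointness**: the coordinates of `Q_lG^ε_l(dip_c w)` are
`(Q_lG^ε_l dip_c w)_t = L^{−ld}·ε·⟨w, (D^ε_A G^ε_lQ_l^*e_t)(c)⟩` in absolute value `≤ L^{−ld}·ε·‖w‖·‖(D^ε_AG^ε_lQ_l^*e_t)(c)‖`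
((Q_lG^ε_l)^* = G^ε_lQ_l^* for the products (I.1.5), `mat_QG_eq`, and the dipole identity). [cite: Balaban1982Higgs1, (1.5) p.604, (2.20) p.610] -/
theorem abs_coord_QG_dip_le (c : HiggsLattice.PBond P 0) (w : E N) (t : HiggsLattice.Site P l × Ix N) :
    |fieldCoord (E N) (HiggsLattice.Site P l)
        (avgQkLin C A l (propagatorK C Finset.univ A msq a l (dip C A c w))) t|
      ≤ (((P.L : ℝ) ^ l) ^ P.d)⁻¹ * (P.mesh 0 *
          (‖w‖ * ‖covDeriv C A (propagatorK C Finset.univ A msq a l (avgQkAdj C A l (cb P N l t))) c‖)) := by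
  set X := avgQkLin C A l ∘ₗ propagatorK C Finset.univ A msq a l with hX
  set Xs := propagatorK C Finset.univ A msq a l ∘ₗ avgQkAdj C A l with hXs
  have hL : (0 : ℝ) ≤ (((P.L : ℝ) ^ l) ^ P.d)⁻¹ := inv_nonneg.mpr (pow_nonneg (pow_nonneg (Nat.cast_nonneg _) l) _)
  -- the coordinate as a matrix entry sum, then adjointness entry by entry
  have h1 : fieldCoord (E N) (HiggsLattice.Site P l) (avgQkLin C A l (propagatorK C Finset.univ A msq a l (dip C A c w))) t
      = ∑ q : HiggsLattice.Site P 0 × Ix N, mat X t q * fieldCoord (E N) (HiggsLattice.Site P 0) (dip C A c w) q := by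
    have : avgQkLin C A l (propagatorK C Finset.univ A msq a l (dip C A c w)) = X (dip C A c w) := rfl
    rw [this, ← mat_mulVec]; rfl
  have h2 : ∑ q : HiggsLattice.Site P 0 × Ix N, mat X t q * fieldCoord (E N) (HiggsLattice.Site P 0) (dip C A c w) q
      = (((P.L : ℝ) ^ l) ^ P.d)⁻¹ *
        (fieldCoord (E N) (HiggsLattice.Site P 0) (dip C A c w) ⬝ᵥ fieldCoord (E N) (HiggsLattice.Site P 0) (Xs (cb P N l t))) := by
    rw [dotProduct, Finset.mul_sum]
    refine Finset.sum_congr rfl fun q _ => ?_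
    rw [hX, mat_QG_eq, ← hXs, B2Eq246ScalarStep.mat_apply]
    ring
  rw [h1, h2, fieldCoord_dip_dotProduct, abs_mul, abs_of_nonneg hL]
  refine mul_le_mul_of_nonneg_left ?_ hL
  rw [abs_mul, abs_of_nonneg (P.mesh_pos 0).le]
  refine mul_le_mul_of_nonneg_left ?_ (P.mesh_pos 0).le
  rw [hXs, LinearMap.comp_apply]
  exact (abs_real_inner_le_norm _ _)

/-- **THE SANDWICH ON A DIPOLE, DIFFERENTIATED** — from the (I.2.25) derivative clause (both outer factors) and the (I.2.34) kernel bound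
at level `l ≤ K` with a common rate `δ > 0`:
`‖(D^ε_A G^ε_lQ_l^*C^{(l)}Q_lG^ε_l dip_c w)(b)‖ ≤ (c_De^{δ}√N)²·c_C·L^{−ld}·K(δ/2)²·e^{δ/2}·ε‖w‖·e^{−(δ/2)|b₋ − c₋|/L^l}`.
[cite: Balaban1982Higgs1, (2.43) p.612, Prop. 2.1 (2.25) p.610, Prop. 2.3 (2.34) p.611] [cite: Balaban1983Higgs3, (2.10) p.426] -/
theorem norm_covDeriv_sandwich_dip_le (hl : l ≤ P.K) {cD cC δ : ℝ} (hcD : 0 ≤ cD) (hcC : 0 ≤ cC) (hδ : 0 < δ)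
    (hDG : ∀ (g : ScalarField P 0 N) (M D : ℝ), (∀ x, ‖g x‖ ≤ M) → 0 ≤ D →
      ∀ b : HiggsLattice.PBond P 0, (∀ z, g z ≠ 0 → D ≤ (HiggsLattice.Site.tdist b.src z : ℝ)) →
        ‖covDeriv C A (propagatorK C Finset.univ A msq a l g) b‖ ≤ cD * Real.exp (-(δ * (D / (P.L : ℝ) ^ l))) * M)
    (hC : ∀ s t : HiggsLattice.Site P l × Ix N,
      |mat (fluctCovA C Finset.univ A msq a l) s t| ≤ cC * Real.exp (-(δ * (HiggsLattice.Site.tdist s.1 t.1 : ℝ))))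
    (c : HiggsLattice.PBond P 0) (w : E N) (b : HiggsLattice.PBond P 0) :
    ‖covDeriv C A (sandwich C A msq a l (dip C A c w)) b‖
      ≤ (cD * Real.exp δ * Real.sqrt N) ^ 2 * cC * (((P.L : ℝ) ^ l) ^ P.d)⁻¹ * profile P N (δ / 2) ^ 2 * Real.exp (δ / 2) *
          (P.mesh 0 * ‖w‖) * Real.exp (-(δ / 2 * ((HiggsLattice.Site.tdist b.src c.src : ℝ) / (P.L : ℝ) ^ l))) := by
  have h0 : sandwich C A msq a l (dip C A c w) = (propagatorK C Finset.univ A msq a l ∘ₗ avgQkAdj C A l)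
      (fluctCovA C Finset.univ A msq a l (avgQkLin C A l (propagatorK C Finset.univ A msq a l (dip C A c w)))) := by
    simp only [sandwich, LinearMap.comp_apply]
  rw [h0]
  refine (norm_covDeriv_apply_le_sum_coord C A _ _ b).trans ?_
  have hK : 0 ≤ profile P N (δ / 2) := profile_nonneg' _ (by linarith)
  have hm0 : 0 < P.mesh 0 := P.mesh_pos 0
  have hεw : 0 ≤ P.mesh 0 * ‖w‖ := mul_nonneg hm0.le (norm_nonneg _)
  -- a colour index to start the convolution (`N = 0`: the coordinate sum is empty)
  rcases isEmpty_or_nonempty (Ix N) with hN | ⟨⟨i₀⟩⟩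
  · rw [Finset.univ_eq_empty, Finset.sum_empty]
    exact mul_nonneg (mul_nonneg (mul_nonneg (mul_nonneg (mul_nonneg (mul_nonneg (sq_nonneg _) hcC)
      (inv_nonneg.mpr (by positivity))) (sq_nonneg _)) (Real.exp_pos _).le) hεw) (Real.exp_pos _).le
  calc ∑ s : HiggsLattice.Site P l × Ix N, |fieldCoord (E N) (HiggsLattice.Site P l)
            (fluctCovA C Finset.univ A msq a l (avgQkLin C A l (propagatorK C Finset.univ A msq a l (dip C A c w)))) s| *
          ‖covDeriv C A ((propagatorK C Finset.univ A msq a l ∘ₗ avgQkAdj C A l) (cb P N l s)) b‖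
      ≤ ∑ s : HiggsLattice.Site P l × Ix N,
          (∑ t : HiggsLattice.Site P l × Ix N, cC * Real.exp (-(δ * (HiggsLattice.Site.tdist s.1 t.1 : ℝ))) *
            ((((P.L : ℝ) ^ l) ^ P.d)⁻¹ * (P.mesh 0 * (‖w‖ *
              (cD * Real.exp δ * Real.exp (-(δ * (HiggsLattice.Site.tdist (blockIter l c.src) t.1 : ℝ))) * Real.sqrt N))))) *
          (cD * Real.exp δ * Real.exp (-(δ * (HiggsLattice.Site.tdist (blockIter l b.src) s.1 : ℝ))) * Real.sqrt N) := by
        refine Finset.sum_le_sum fun s _ => ?_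
        have h1 : |fieldCoord (E N) (HiggsLattice.Site P l)
              (fluctCovA C Finset.univ A msq a l (avgQkLin C A l (propagatorK C Finset.univ A msq a l (dip C A c w)))) s|
            ≤ ∑ t : HiggsLattice.Site P l × Ix N, cC * Real.exp (-(δ * (HiggsLattice.Site.tdist s.1 t.1 : ℝ))) *
              ((((P.L : ℝ) ^ l) ^ P.d)⁻¹ * (P.mesh 0 * (‖w‖ *
                (cD * Real.exp δ * Real.exp (-(δ * (HiggsLattice.Site.tdist (blockIter l c.src) t.1 : ℝ))) * Real.sqrt N)))) := by
          refine (abs_fieldCoord_apply_le (fluctCovA C Finset.univ A msq a l) _ s).trans (Finset.sum_le_sum fun t _ => ?_)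
          refine mul_le_mul (hC s t) ((abs_coord_QG_dip_le C A msq a c w t).trans ?_) (abs_nonneg _) (by positivity)
          refine mul_le_mul_of_nonneg_left (mul_le_mul_of_nonneg_left (mul_le_mul_of_nonneg_left ?_ (norm_nonneg _))
            (P.mesh_pos 0).le) (inv_nonneg.mpr (by positivity))
          exact norm_covDeriv_G_avgQkAdj_cb_le C A msq a hl hcD hδ.le hDG t c
        have h2 : ‖covDeriv C A ((propagatorK C Finset.univ A msq a l ∘ₗ avgQkAdj C A l) (cb P N l s)) b‖
            ≤ cD * Real.exp δ * Real.exp (-(δ * (HiggsLattice.Site.tdist (blockIter l b.src) s.1 : ℝ))) * Real.sqrt N := by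
          rw [LinearMap.comp_apply]
          exact norm_covDeriv_G_avgQkAdj_cb_le C A msq a hl hcD hδ.le hDG s b
        exact mul_le_mul h1 h2 (norm_nonneg _) (Finset.sum_nonneg fun t _ => by positivity)
    _ = (cD * Real.exp δ * Real.sqrt N) ^ 2 * cC * (((P.L : ℝ) ^ l) ^ P.d)⁻¹ * (P.mesh 0 * ‖w‖) *
          ∑ s : HiggsLattice.Site P l × Ix N, ∑ t : HiggsLattice.Site P l × Ix N,
            Real.exp (-(δ * (HiggsLattice.Site.tdist (blockIter l b.src) s.1 : ℝ))) *
              Real.exp (-(δ * (HiggsLattice.Site.tdist s.1 t.1 : ℝ))) *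
              Real.exp (-(δ * (HiggsLattice.Site.tdist (blockIter l c.src) t.1 : ℝ))) := by
        rw [Finset.mul_sum]
        refine Finset.sum_congr rfl fun s _ => ?_
        rw [Finset.sum_mul, Finset.mul_sum]
        refine Finset.sum_congr rfl fun t _ => ?_
        ring
    _ ≤ (cD * Real.exp δ * Real.sqrt N) ^ 2 * cC * (((P.L : ℝ) ^ l) ^ P.d)⁻¹ * (P.mesh 0 * ‖w‖) *
          (profile P N (δ / 2) ^ 2 *
            Real.exp (-(δ / 2 * (HiggsLattice.Site.tdist (blockIter l b.src) (blockIter l c.src) : ℝ)))) :=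
        mul_le_mul_of_nonneg_left (sum3_le hδ (blockIter l b.src) (blockIter l c.src) i₀) (by positivity)
    _ ≤ (cD * Real.exp δ * Real.sqrt N) ^ 2 * cC * (((P.L : ℝ) ^ l) ^ P.d)⁻¹ * (P.mesh 0 * ‖w‖) *
          (profile P N (δ / 2) ^ 2 * (Real.exp (δ / 2) *
            Real.exp (-(δ / 2 * ((HiggsLattice.Site.tdist b.src c.src : ℝ) / (P.L : ℝ) ^ l))))) :=
        mul_le_mul_of_nonneg_left (mul_le_mul_of_nonneg_left (exp_blockIter_le hl hδ.le b.src c.src) (pow_nonneg hK 2))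
          (by positivity)
    _ = _ := by ring

end Engine

/-! ## §2 The pieces: `ε^{−d}Σ_i‖(D^ε_{A,μ}G^η_{(j)}D^{ε*}_{A,ν})(x,x′)e_i‖`, piece by piece -/

section PieceBounds

variable (C : ChargeData N) (A : HiggsLattice.VecField P 0) (msq : ℝ) {a : ℝ} {k j : ℕ}

/-- **The twice-differentiated kernel of the piece `j`** in the column-sum norm:
`ε^{−d}Σ_i‖(D^ε_{A,μ}G^η_{(j)}D^{ε*}_{A,ν})(x, x′)e_i‖ := ε^{−d}·ε^{−1}·Σ_i‖(D^ε_A G^η_{(j)}(dip_{⟨x′,ν⟩}e_i))(⟨x,μ⟩)‖` (the dipole realises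
`ε·D^{ε*}_{A,ν}` at `⟨x′,ν⟩`, `sum_inner_dip`). [cite: Balaban1983Higgs3, (2.10) p.426] -/
def mixedTerm (a : ℝ) (k j : ℕ) (μ ν : Fin P.d) (x x' : HiggsLattice.Site P 0) : ℝ :=
  (P.mesh 0 ^ P.d)⁻¹ * ((P.mesh 0)⁻¹ *
    ∑ i : Ix N, ‖covDeriv C A (pieceA C A msq a k j (dip C A ⟨x', ν⟩ (onb N i))) ⟨x, μ⟩‖)

/-- `mixedTerm ≥ 0`. [cite: Balaban1983Higgs3, (2.10) p.426] -/
theorem mixedTerm_nonneg (μ ν : Fin P.d) (x x' : HiggsLattice.Site P 0) : 0 ≤ mixedTerm C A msq a k j μ ν x x' :=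
  mul_nonneg (inv_nonneg.mpr (pow_nonneg (P.mesh_pos 0).le _))
    (mul_nonneg (inv_nonneg.mpr (P.mesh_pos 0).le) (Finset.sum_nonneg fun _ _ => norm_nonneg _))

/-- scaling bookkeeping: `ε^{−d}·L^{−jd} = (L^jε)^{−d}`. [cite: Balaban1982Higgs1, (1.19) p.607] -/
private theorem inv_mesh_zero_pow_mul (j : ℕ) :
    (P.mesh 0 ^ P.d)⁻¹ * (((P.L : ℝ) ^ j) ^ P.d)⁻¹ = (P.mesh j ^ P.d)⁻¹ := by
  rw [mesh_eq_pow_mul P j, mul_pow, mul_inv, mul_comm]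

/-- The dipole at `⟨x′,ν⟩` is at distance `≥ |x − x′| − 1` from `x`: both its sites `x′`, `x′ + εe_ν` are.
[cite: Balaban1982Higgs1, (1.3) p.604] -/
theorem dip_support_dist (ν : Fin P.d) (x x' : HiggsLattice.Site P 0) (w : E N) {z : HiggsLattice.Site P 0}
    (hz : dip C A ⟨x', ν⟩ w z ≠ 0) :
    max 0 ((HiggsLattice.Site.tdist x x' : ℝ) - 1) ≤ (HiggsLattice.Site.tdist x z : ℝ) := by
  refine max_le (Nat.cast_nonneg _) ?_
  by_cases h₁ : z = x'
  · rw [h₁]; linarith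
  · by_cases h₂ : z = x'.shift ν
    · have ht := tdist_triangle_real x (x'.shift ν) x'
      have h1 : (HiggsLattice.Site.tdist (x'.shift ν) x' : ℝ) ≤ 1 := by
        rw [tdist_comm]; exact_mod_cast tdist_shift_le_one x' ν
      rw [h₂]; linarith
    · exact absurd (dip_eq_zero_of_ne (C := C) (A := A) ⟨x', ν⟩ w h₁ h₂) hz

/-- **Piece `j = 0`**: `ε^{−d}Σ_i‖(D^ε_AG^ε_1D^{ε*}_A)(x,x′)e_i‖ ≤ 2N·c₀′L·e^{ρ}·ε^{−d}·e^{−ρ|x − x′|/L}` from the (I.2.25) derivative clause at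
level `1` on the dipole source (`G^η_{(0)} = G^ε_1`; source `dip_{⟨x′,ν⟩}e_i`: sup `≤ 2`, support `{x′, x′ + εe_ν}`; `ε^{−1}·(Lε) = L`).
[cite: Balaban1983Higgs3, (2.6) p.424, (2.10) p.426] [cite: Balaban1982Higgs1, Prop. 2.1 (2.25) p.610] -/
theorem mixed_piece_zero_le {c₀' ρ : ℝ} (hc₀' : 0 ≤ c₀') (hρ : 0 ≤ ρ)
    (hDG : ∀ (g : ScalarField P 0 N) (M D : ℝ), (∀ x, ‖g x‖ ≤ M) → 0 ≤ D →
      ∀ b : HiggsLattice.PBond P 0, (∀ z, g z ≠ 0 → D ≤ (HiggsLattice.Site.tdist b.src z : ℝ)) →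
        ‖covDeriv C A (propagatorK C Finset.univ A msq a 1 g) b‖
          ≤ c₀' * P.mesh 1 * Real.exp (-(ρ * (D / (P.L : ℝ) ^ 1))) * M)
    (μ ν : Fin P.d) (x x' : HiggsLattice.Site P 0) :
    mixedTerm C A msq a k 0 μ ν x x'
      ≤ ((N : ℝ) * 2 * c₀' * (P.L : ℝ) * Real.exp ρ) * (P.mesh 0 ^ P.d)⁻¹ *
          Real.exp (-(ρ * ((HiggsLattice.Site.tdist x x' : ℝ) / (P.L : ℝ) ^ 1))) := by
  set X := Real.exp (-(ρ * ((HiggsLattice.Site.tdist x x' : ℝ) / (P.L : ℝ) ^ 1))) with hX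
  set D : ℝ := max 0 ((HiggsLattice.Site.tdist x x' : ℝ) - 1) with hD
  have hL1 : (1 : ℝ) ≤ P.L := by exact_mod_cast P.hL
  have hm0 : 0 < P.mesh 0 := P.mesh_pos 0
  -- the decay factor at `D ≥ |x − x′| − 1`: `e^{−ρD/L} ≤ e^{ρ}·e^{−ρ|x−x′|/L}`
  have hexp : Real.exp (-(ρ * (D / (P.L : ℝ) ^ 1))) ≤ Real.exp ρ * X := by
    rw [hX, ← Real.exp_add]
    apply Real.exp_le_exp.mpr
    rw [pow_one]
    have hL0 : (0 : ℝ) < P.L := by linarith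
    have h1 : (HiggsLattice.Site.tdist x x' : ℝ) - 1 ≤ D := le_max_right _ _
    have h2 : ρ * (((HiggsLattice.Site.tdist x x' : ℝ) - 1) / P.L) ≤ ρ * (D / P.L) :=
      mul_le_mul_of_nonneg_left (div_le_div_of_nonneg_right h1 hL0.le) hρ
    have h3 : ρ / P.L ≤ ρ := div_le_self hρ hL1
    have h4 : ρ * (((HiggsLattice.Site.tdist x x' : ℝ) - 1) / P.L)
        = ρ * ((HiggsLattice.Site.tdist x x' : ℝ) / P.L) - ρ / P.L := by ring
    linarith
  have h1 : ∀ i : Ix N, ‖covDeriv C A (pieceA C A msq a k 0 (dip C A ⟨x', ν⟩ (onb N i))) ⟨x, μ⟩‖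
      ≤ c₀' * P.mesh 1 * (Real.exp ρ * X) * 2 := by
    intro i
    rw [pieceA_zero]
    have h := hDG (dip C A ⟨x', ν⟩ (onb N i)) 2 D
      (fun y => by have := norm_dip_le (C := C) (A := A) ⟨x', ν⟩ (onb N i) y; rwa [norm_onb, mul_one] at this)
      (le_max_left _ _) ⟨x, μ⟩ (fun z hz => dip_support_dist C A ν x x' (onb N i) hz)
    refine h.trans ?_
    exact mul_le_mul_of_nonneg_right (mul_le_mul_of_nonneg_left hexp (mul_nonneg hc₀' (P.mesh_pos 1).le)) (by norm_num)
  have hsum : ∑ i : Ix N, ‖covDeriv C A (pieceA C A msq a k 0 (dip C A ⟨x', ν⟩ (onb N i))) ⟨x, μ⟩‖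
      ≤ N * (c₀' * P.mesh 1 * (Real.exp ρ * X) * 2) := by
    refine (Finset.sum_le_sum fun i _ => h1 i).trans ?_
    rw [Finset.sum_const, card_Ix, nsmul_eq_mul]
  unfold mixedTerm
  refine (mul_le_mul_of_nonneg_left (mul_le_mul_of_nonneg_left hsum (inv_nonneg.mpr hm0.le))
    (inv_nonneg.mpr (pow_nonneg hm0.le _))).trans (le_of_eq ?_)
  rw [mesh_eq_pow_mul P 1, pow_one]
  field_simp

/-- **Piece `1 ≤ j < k`**: `ε^{−d}Σ_i‖(D^ε_AG^η_{(j)}D^{ε*}_A)(x,x′)e_i‖ ≤ N²a²c₀′²c₁·e^{2δ}e^{δ/2}K(δ/2)² · (L^jε)^{−d} · e^{−(δ/2)|x − x′|/L^j}`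
— the scaling `ε^{−d}·ε^{−1}·a_j²(L^jε)^{−4}·(L^jε)^{1+2+1}·L^{−jd}·ε = a_j²(L^jε)^{−d}` of the print's «rescaling from the η-lattice to the
L^{−j}-lattice», both derivatives on the outer factors. [cite: Balaban1983Higgs3, (2.6) p.424, (2.10) p.426]
[cite: Balaban1982Higgs1, (2.43) p.612] -/
theorem mixed_piece_pos_le (ha : 0 < a) (hL1 : 1 < P.L) (hj1 : 1 ≤ j) (hjk : j < k) (hjK : j ≤ P.K)
    {c₀' c₁ δ : ℝ} (hc₀' : 0 ≤ c₀') (hc₁ : 0 ≤ c₁) (hδ : 0 < δ)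
    (hDG : ∀ (g : ScalarField P 0 N) (M D : ℝ), (∀ x, ‖g x‖ ≤ M) → 0 ≤ D →
      ∀ b : HiggsLattice.PBond P 0, (∀ z, g z ≠ 0 → D ≤ (HiggsLattice.Site.tdist b.src z : ℝ)) →
        ‖covDeriv C A (propagatorK C Finset.univ A msq a j g) b‖
          ≤ c₀' * P.mesh j * Real.exp (-(δ * (D / (P.L : ℝ) ^ j))) * M)
    (hC : ∀ s t : HiggsLattice.Site P j × Ix N,
      |mat (fluctCovA C Finset.univ A msq a j) s t| ≤ c₁ * P.mesh j ^ 2 * Real.exp (-(δ * (HiggsLattice.Site.tdist s.1 t.1 : ℝ))))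
    (μ ν : Fin P.d) (x x' : HiggsLattice.Site P 0) :
    mixedTerm C A msq a k j μ ν x x'
      ≤ ((N : ℝ) ^ 2 * a ^ 2 * c₀' ^ 2 * c₁ * (Real.exp δ ^ 2 * Real.exp (δ / 2) * profile P N (δ / 2) ^ 2)) *
        (P.mesh j ^ P.d)⁻¹ *
          Real.exp (-(δ / 2 * ((HiggsLattice.Site.tdist x x' : ℝ) / (P.L : ℝ) ^ j))) := by
  set X := Real.exp (-(δ / 2 * ((HiggsLattice.Site.tdist x x' : ℝ) / (P.L : ℝ) ^ j))) with hX
  have hm0 : 0 < P.mesh 0 := P.mesh_pos 0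
  have hmj : 0 < P.mesh j := P.mesh_pos j
  have hLj : (0 : ℝ) < (P.L : ℝ) ^ j := pow_pos (by exact_mod_cast P.hL) j
  have hK : 0 ≤ profile P N (δ / 2) := profile_nonneg' _ (by linarith)
  have hsw : ∀ i : Ix N, ‖covDeriv C A (pieceA C A msq a k j (dip C A ⟨x', ν⟩ (onb N i))) ⟨x, μ⟩‖
      ≤ coeff221 P a j ^ 2 * ((c₀' * P.mesh j * Real.exp δ * Real.sqrt N) ^ 2 * (c₁ * P.mesh j ^ 2) *
          (((P.L : ℝ) ^ j) ^ P.d)⁻¹ * profile P N (δ / 2) ^ 2 * Real.exp (δ / 2) * (P.mesh 0 * 1) * X) := by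
    intro i
    rw [pieceA_of_pos hj1 hjk, termA, LinearMap.smul_apply, covDeriv_smul'', norm_smul, Real.norm_eq_abs,
      abs_of_nonneg (sq_nonneg _)]
    refine mul_le_mul_of_nonneg_left ?_ (sq_nonneg _)
    have h := norm_covDeriv_sandwich_dip_le C A msq a hjK (by positivity) (by positivity) hδ hDG hC ⟨x', ν⟩ (onb N i) ⟨x, μ⟩
    rw [norm_onb] at h
    exact h
  have hsum : ∑ i : Ix N, ‖covDeriv C A (pieceA C A msq a k j (dip C A ⟨x', ν⟩ (onb N i))) ⟨x, μ⟩‖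
      ≤ N * (coeff221 P a j ^ 2 * ((c₀' * P.mesh j * Real.exp δ * Real.sqrt N) ^ 2 * (c₁ * P.mesh j ^ 2) *
          (((P.L : ℝ) ^ j) ^ P.d)⁻¹ * profile P N (δ / 2) ^ 2 * Real.exp (δ / 2) * (P.mesh 0 * 1) * X)) := by
    refine (Finset.sum_le_sum fun i _ => hsw i).trans ?_
    rw [Finset.sum_const, card_Ix, nsmul_eq_mul]
  unfold mixedTerm
  refine (mul_le_mul_of_nonneg_left (mul_le_mul_of_nonneg_left hsum (inv_nonneg.mpr hm0.le))
    (inv_nonneg.mpr (pow_nonneg hm0.le _))).trans ?_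
  have hsq : (c₀' * P.mesh j * Real.exp δ * Real.sqrt N) ^ 2 = (c₀' * P.mesh j * Real.exp δ) ^ 2 * N := by
    rw [mul_pow (c₀' * P.mesh j * Real.exp δ), Real.sq_sqrt (Nat.cast_nonneg _)]
  rw [hsq, B1Eq243HiggsModel.coeff221_sq]
  -- the scaling identity
  have hid : (P.mesh 0 ^ P.d)⁻¹ * ((P.mesh 0)⁻¹ * (N * (B1.aSeq a (P.L : ℝ) j ^ 2 * (P.mesh j ^ 4)⁻¹ *
        ((c₀' * P.mesh j * Real.exp δ) ^ 2 * N * (c₁ * P.mesh j ^ 2) *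
          (((P.L : ℝ) ^ j) ^ P.d)⁻¹ * profile P N (δ / 2) ^ 2 * Real.exp (δ / 2) * (P.mesh 0 * 1) * X))))
      = B1.aSeq a (P.L : ℝ) j ^ 2 * (((N : ℝ) ^ 2 * c₀' ^ 2 * c₁ *
          (Real.exp δ ^ 2 * Real.exp (δ / 2) * profile P N (δ / 2) ^ 2)) * (P.mesh j ^ P.d)⁻¹ * X) := by
    calc (P.mesh 0 ^ P.d)⁻¹ * ((P.mesh 0)⁻¹ * (N * (B1.aSeq a (P.L : ℝ) j ^ 2 * (P.mesh j ^ 4)⁻¹ *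
          ((c₀' * P.mesh j * Real.exp δ) ^ 2 * N * (c₁ * P.mesh j ^ 2) *
            (((P.L : ℝ) ^ j) ^ P.d)⁻¹ * profile P N (δ / 2) ^ 2 * Real.exp (δ / 2) * (P.mesh 0 * 1) * X))))
        = B1.aSeq a (P.L : ℝ) j ^ 2 * (((N : ℝ) ^ 2 * c₀' ^ 2 * c₁ *
            (Real.exp δ ^ 2 * Real.exp (δ / 2) * profile P N (δ / 2) ^ 2)) * X) *
            ((P.mesh 0 ^ P.d)⁻¹ * (((P.L : ℝ) ^ j) ^ P.d)⁻¹) * ((P.mesh j ^ 4)⁻¹ * P.mesh j ^ 4) *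
            ((P.mesh 0)⁻¹ * P.mesh 0) := by ring
      _ = _ := by
        rw [inv_mesh_zero_pow_mul, inv_mul_cancel₀ (pow_ne_zero 4 hmj.ne'), inv_mul_cancel₀ hm0.ne']; ring
  rw [hid]
  have hrest : 0 ≤ ((N : ℝ) ^ 2 * c₀' ^ 2 * c₁ * (Real.exp δ ^ 2 * Real.exp (δ / 2) * profile P N (δ / 2) ^ 2)) *
      (P.mesh j ^ P.d)⁻¹ * X := by positivity
  calc B1.aSeq a (P.L : ℝ) j ^ 2 * (((N : ℝ) ^ 2 * c₀' ^ 2 * c₁ *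
          (Real.exp δ ^ 2 * Real.exp (δ / 2) * profile P N (δ / 2) ^ 2)) * (P.mesh j ^ P.d)⁻¹ * X)
      ≤ a ^ 2 * (((N : ℝ) ^ 2 * c₀' ^ 2 * c₁ *
          (Real.exp δ ^ 2 * Real.exp (δ / 2) * profile P N (δ / 2) ^ 2)) * (P.mesh j ^ P.d)⁻¹ * X) :=
        mul_le_mul_of_nonneg_right (aSeq_sq_le ha hL1 hj1) hrest
    _ = _ := by ring

/-- **Pieces `j ≥ k`, `j ≥ 1` vanish** (no such terms in (2.6)). [cite: Balaban1983Higgs3, (2.6) p.424] -/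
theorem mixedTerm_eq_zero_of_le (hj1 : 1 ≤ j) (hkj : k ≤ j) (μ ν : Fin P.d) (x x' : HiggsLattice.Site P 0) :
    mixedTerm C A msq a k j μ ν x x' = 0 := by
  unfold mixedTerm
  simp [pieceA_of_le hj1 hkj, covDeriv_zero'']

end PieceBounds

/-! ## §3 The constant and the theorem -/

/-- **The constant `O(1)` of the twice-differentiated clause of (2.10)** assembled from the constants of (I.2.25) (`c₀′`, derivative) and
of (I.2.34) (`c₁`), the common decay rate `δ`, `N`, `a`, `L`, `d` (through the lattice-sum profile `K = N·K_d`).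
[cite: Balaban1983Higgs3, (2.10) p.426] -/
def cstMix (d L N : ℕ) (a c₀' c₁ δ : ℝ) : ℝ :=
  1 + (N : ℝ) * 2 * c₀' * (L : ℝ) * Real.exp δ +
    (N : ℝ) ^ 2 * a ^ 2 * c₀' ^ 2 * c₁ *
      (Real.exp δ ^ 2 * Real.exp (δ / 2) * ((nCol N : ℝ) * B4Sect5Proof.latticeConst d (δ / 2)) ^ 2)

section Constant

variable {d L N : ℕ} {a c₀' c₁ δ : ℝ}

/-- the two summands of `cstMix` are nonnegative. [cite: Balaban1983Higgs3, (2.10) p.426] -/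
private theorem cstMix_summands_nonneg (hc₀' : 0 ≤ c₀') (hc₁ : 0 ≤ c₁) :
    0 ≤ (N : ℝ) * 2 * c₀' * (L : ℝ) * Real.exp δ ∧
    0 ≤ (N : ℝ) ^ 2 * a ^ 2 * c₀' ^ 2 * c₁ *
      (Real.exp δ ^ 2 * Real.exp (δ / 2) * ((nCol N : ℝ) * B4Sect5Proof.latticeConst d (δ / 2)) ^ 2) :=
  ⟨by positivity, by positivity⟩

/-- `cstMix > 0`. [cite: Balaban1983Higgs3, (2.10) p.426] -/
theorem cstMix_pos (hc₀' : 0 ≤ c₀') (hc₁ : 0 ≤ c₁) : 0 < cstMix d L N a c₀' c₁ δ := by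
  obtain ⟨h1, h2⟩ := cstMix_summands_nonneg (d := d) (L := L) (N := N) (a := a) (δ := δ) hc₀' hc₁
  unfold cstMix; linarith

/-- `2N·c₀′L·e^{δ} ≤ cstMix`. [cite: Balaban1983Higgs3, (2.10) p.426] -/
theorem le_cstMix_zero (hc₀' : 0 ≤ c₀') (hc₁ : 0 ≤ c₁) :
    (N : ℝ) * 2 * c₀' * (L : ℝ) * Real.exp δ ≤ cstMix d L N a c₀' c₁ δ := by
  obtain ⟨h1, h2⟩ := cstMix_summands_nonneg (d := d) (L := L) (N := N) (a := a) (δ := δ) hc₀' hc₁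
  unfold cstMix; linarith

/-- `N²a²c₀′²c₁·e^{2δ}e^{δ/2}K(δ/2)² ≤ cstMix`. [cite: Balaban1983Higgs3, (2.10) p.426] -/
theorem le_cstMix_pos (hc₀' : 0 ≤ c₀') (hc₁ : 0 ≤ c₁) :
    (N : ℝ) ^ 2 * a ^ 2 * c₀' ^ 2 * c₁ *
      (Real.exp δ ^ 2 * Real.exp (δ / 2) * ((nCol N : ℝ) * B4Sect5Proof.latticeConst d (δ / 2)) ^ 2)
      ≤ cstMix d L N a c₀' c₁ δ := by
  obtain ⟨h1, h2⟩ := cstMix_summands_nonneg (d := d) (L := L) (N := N) (a := a) (δ := δ) hc₀' hc₁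
  unfold cstMix; linarith

end Constant

section Main

/-- Rate weakening in a decay factor. [folklore] -/
private theorem exp_rate_mono {ρ ρ' s : ℝ} (h : ρ' ≤ ρ) (hs : 0 ≤ s) : Real.exp (-(ρ * s)) ≤ Real.exp (-(ρ' * s)) :=
  Real.exp_le_exp.mpr (by nlinarith)

/-- weakening in the exponent: `e^{−u} ≤ e^{−v}` when `v ≤ u`. [folklore] -/
private theorem exp_le_exp_of_le {u v : ℝ} (h : v ≤ u) : Real.exp (-u) ≤ Real.exp (-v) :=
  Real.exp_le_exp.mpr (neg_le_neg h)

/-- **B3 (2.10) p. 426 [PDF 16], THE TWICE-DIFFERENTIATED CLAUSE, PROVED AT A REGULAR NON-CONSTANT BACKGROUND `B̃ = A` ON THE TORUS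
`Ω = T_η`, uniformly in the volume.**  For `d, L` (`L` odd `> 1`), `a > 0`, `m² > 0`, `N`, charge data `C = (e, U)` there are a threshold
`K₀,min` and, for every cube size `K₀`, constants `t(K₀), δ₁(K₀), C(K₀) > 0` such that: for every `K₀ ≥ K₀,min`, every volume `P` of the
(Higgs)₂,₃ torus family with these `d, L` (`S : Shape P`) tiled by `K₀`-cubes (`K₀ ∣ M`, `3K₀ ≤ 2M`), every scale `1 ≤ k ≤ K` with
`L^kε ≤ 1`, and every `δ_A`-REGULAR configuration `A` on `T_ε` (`|A(⟨z + e_ν, μ⟩) − A(⟨z, μ⟩)| ≤ δ_A`) with the smallness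
`L^k·δ_A·|e| ≤ t(K₀)`: for all `j`, `μ, ν`, `x, x′ ∈ T_η`,
`ε^{−d}Σ_i‖(D^ε_{A,μ}G^η_{(j)}D^{ε*}_{A,ν})(T_η, A; x, x′)e_i‖ ≤ C(L^jη)^{−d}e^{−δ₁(L^jη)^{−1}|x−x′|}` (`|x − x′| = ε·tdist`).
Print: *"and if the propagator is differentiated, then for each differentiation, there is an additional factor (L^jη)^{−1} on the right
side. … They all are obtained by rescaling from the η-lattice to the L^{−j}-lattice and application of Propositions I.2.1 and I.2.3."*
Route: exactly that — the pieces (2.6) are the terms of (I.2.43) at `A` (r14's `pieceA`); in each term `a_j²(L^jε)^{−4}G^ε_jQ_j^*C^{(j)}Q_jG^ε_j`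
the left derivative falls on the first factor, the right (adjoint) derivative on the last one, both bounded through Proposition I.2.1
(2.25) at a regular `A` on the torus (`B1Ineq225RegularTorus.norm_covDeriv_propagatorK_reg_decay`; the last factor after the adjointness
`(Q_jG^ε_j)^* = G^ε_jQ_j^*`, `abs_coord_QG_dip_le`), the middle one through (I.2.34) (`B1Props21to23RegularTorus.ineq234_236_regular_torus_std`),
the three-kernel convolution on `T^{(j)}` (`sum3_le`); the piece `G^η_{(0)} = G^ε_1` is (2.25) at level `1`.  Honest scope: torus only
(`Ω = T_η`); `m² > 0`; the `Shape` sub-family and the cube tiling of the cited torus theorems; constants depend on `K₀` (as the inputs);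
`|·|` of a block = column sum of Euclidean norms over an orthonormal basis of `ℝ^N`.
[cite: Balaban1983Higgs3, (2.6) p.424, (2.10) p.426] [cite: Balaban1982Higgs1, Prop. 2.1 (2.25) p.610, Prop. 2.3 (2.34) p.611, (2.43) p.612] -/
theorem ineq210_mixed_regularTorus (d L : ℕ) (hL : Odd L ∧ 1 < L) {a : ℝ} (ha : 0 < a) {msq : ℝ} (hmsq : 0 < msq)
    (N : ℕ) (C : ChargeData N) :
    ∃ K₀min : ℕ, ∃ t δ₁ Cst : ℕ → ℝ, (∀ K₀, 0 < t K₀ ∧ 0 < δ₁ K₀ ∧ 0 < Cst K₀) ∧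
      ∀ K₀ : ℕ, K₀min ≤ K₀ →
      ∀ (P : HiggsLattice.Params) (_S : Shape P), P.d = d → P.L = L → K₀ ∣ P.M → 3 * K₀ ≤ 2 * P.M →
      ∀ {k : ℕ}, 1 ≤ k → k ≤ P.K → P.mesh k ≤ 1 →
      ∀ (A : HiggsLattice.VecField P 0) {δA : ℝ}, 0 ≤ δA →
        (∀ (z : HiggsLattice.Site P 0) (μ ν : Fin P.d), |A ⟨z.shift ν, μ⟩ - A ⟨z, μ⟩| ≤ δA) →
        (P.L : ℝ) ^ k * δA * |C.e| ≤ t K₀ →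
        ∀ (j : ℕ) (μ ν : Fin P.d) (x x' : HiggsLattice.Site P 0),
          mixedTerm C A msq a k j μ ν x x'
            ≤ Cst K₀ * (P.mesh j ^ P.d)⁻¹ * Real.exp (-(δ₁ K₀ * ((HiggsLattice.Site.tdist x x' : ℝ) / (P.L : ℝ) ^ j))) := by
  have hL2 : 2 ≤ L := hL.2
  obtain ⟨c₀', hc₀', K₂, e₂, ρ₂, hpos₂, hD⟩ :=
    B1Ineq225RegularTorus.norm_covDeriv_propagatorK_reg_decay d L hL2 ha hmsq N C 1 1 1 zero_le_one one_pos
  obtain ⟨K₃, tA, c₁, ρ₃, hpos₃, hCov⟩ := B1Props21to23RegularTorus.ineq234_236_regular_torus_std d L hL ha hmsq N C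
  -- the common decay rate of the two inputs
  obtain ⟨δ, hδ⟩ : ∃ δ : ℕ → ℝ, ∀ K₀, δ K₀ = min (ρ₂ K₀) (ρ₃ K₀) := ⟨_, fun _ => rfl⟩
  have hδpos : ∀ K₀, 0 < δ K₀ := fun K₀ => by rw [hδ]; exact lt_min (hpos₂ K₀).2 (hpos₃ K₀).2.2
  have hLpos : (0 : ℝ) < L := by exact_mod_cast (by omega : 0 < L)
  refine ⟨max K₂ K₃, fun K₀ => min (tA K₀) (e₂ K₀), fun K₀ => δ K₀ / (2 * L),
    fun K₀ => cstMix d L N a c₀' (c₁ K₀) (δ K₀), fun K₀ => ⟨?_, ?_, ?_⟩, ?_⟩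
  · exact lt_min (hpos₃ K₀).1 (hpos₂ K₀).1
  · exact div_pos (hδpos K₀) (by positivity)
  · exact cstMix_pos hc₀'.le (hpos₃ K₀).2.1.le
  intro K₀ hK₀ P S hPd hPL hK₀M h3M k hk1 hkK hmesh A δA hδA hreg ht j μ ν x x'
  have hK₂ : K₂ ≤ K₀ := (le_max_left _ _).trans hK₀
  have hK₃ : K₃ ≤ K₀ := (le_max_right _ _).trans hK₀
  subst hPd hPL
  have hL1 : 1 < P.L := hL.2
  have hLge1 : (1 : ℝ) ≤ P.L := by exact_mod_cast P.hL
  have hc₁ : 0 ≤ c₁ K₀ := (hpos₃ K₀).2.1.le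
  have hδK : 0 < δ K₀ := hδpos K₀
  have hδ₂ : δ K₀ ≤ ρ₂ K₀ := by rw [hδ]; exact min_le_left _ _
  have hδ₃ : δ K₀ ≤ ρ₃ K₀ := by rw [hδ]; exact min_le_right _ _
  have htA : (P.L : ℝ) ^ k * δA * |C.e| ≤ tA K₀ := ht.trans (min_le_left _ _)
  have hte₂ : (P.L : ℝ) ^ k * δA * |C.e| ≤ e₂ K₀ := ht.trans (min_le_right _ _)
  have hCst : 0 ≤ cstMix P.d P.L N a c₀' (c₁ K₀) (δ K₀) := (cstMix_pos hc₀'.le hc₁).le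
  -- the two inputs at every level `1 ≤ l ≤ k`, in the engine's form with the common rate `δ K₀`
  have hDl : ∀ {l : ℕ}, 1 ≤ l → l ≤ k → ∀ (g : ScalarField P 0 N) (M D : ℝ), (∀ x, ‖g x‖ ≤ M) → 0 ≤ D →
      ∀ b : HiggsLattice.PBond P 0, (∀ z, g z ≠ 0 → D ≤ (HiggsLattice.Site.tdist b.src z : ℝ)) →
        ‖covDeriv C A (propagatorK C Finset.univ A msq a l g) b‖
          ≤ c₀' * P.mesh l * Real.exp (-(δ K₀ * (D / (P.L : ℝ) ^ l))) * M := by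
    intro l hl1 hlk g M D hg hD0 b hsupp
    have hmesh_l : P.mesh l ≤ 1 := (mesh_mono P hlk).trans hmesh
    have h := hD K₀ hK₂ P rfl rfl hK₀M h3M hl1 (hlk.trans hkK) hmesh_l A (hpos₂ K₀).1 le_rfl
      (reg223_of_small C A hlk hmesh_l (hpos₂ K₀).1 hδA hreg hte₂ le_rfl) g M D hg hD0 b hsupp
    refine h.trans ?_
    have hM : 0 ≤ M := (norm_nonneg _).trans (hg b.src)
    have hml : 0 < P.mesh l := P.mesh_pos l
    have hexp := exp_rate_mono hδ₂ (show (0 : ℝ) ≤ D / (P.L : ℝ) ^ l by positivity)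
    exact mul_le_mul_of_nonneg_right (mul_le_mul_of_nonneg_left hexp (by positivity)) hM
  have hCl : ∀ {l : ℕ}, 1 ≤ l → l < k → ∀ s t : HiggsLattice.Site P l × Ix N,
      |mat (fluctCovA C Finset.univ A msq a l) s t|
        ≤ c₁ K₀ * P.mesh l ^ 2 * Real.exp (-(δ K₀ * (HiggsLattice.Site.tdist s.1 t.1 : ℝ))) := by
    intro l hl1 hlk s t
    have hmesh_l : P.mesh l ≤ 1 := (mesh_mono P hlk.le).trans hmesh
    have htl : (P.L : ℝ) ^ l * δA * |C.e| ≤ tA K₀ := by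
      have hpow : (P.L : ℝ) ^ l ≤ (P.L : ℝ) ^ k := pow_le_pow_right₀ hLge1 hlk.le
      have h0 : 0 ≤ δA * |C.e| := mul_nonneg hδA (abs_nonneg _)
      nlinarith
    have h := (hCov K₀ hK₃ P S rfl rfl hK₀M h3M hl1 (lt_of_lt_of_le hlk hkK) hmesh_l A hδA hreg htl Finset.univ
      (p := s) (q := t) (Finset.mem_univ _) (Finset.mem_univ _)).1
    rw [HiggsCondCov232.condCov232_univ] at h
    refine h.trans ?_
    have hexp := exp_rate_mono hδ₃ (Nat.cast_nonneg _ : (0 : ℝ) ≤ (HiggsLattice.Site.tdist s.1 t.1 : ℝ))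
    calc P.mesh l ^ 2 * c₁ K₀ * Real.exp (-(ρ₃ K₀ * (HiggsLattice.Site.tdist s.1 t.1 : ℝ)))
        ≤ P.mesh l ^ 2 * c₁ K₀ * Real.exp (-(δ K₀ * (HiggsLattice.Site.tdist s.1 t.1 : ℝ))) :=
          mul_le_mul_of_nonneg_left hexp (by positivity)
      _ = _ := by ring
  -- rate bookkeeping: `δ/(2L) ≤ δ/2` and the `j = 0` exponent (rate `δ` at level `1` beats rate `δ/(2L)` at level `0`)
  have hrate : δ K₀ / (2 * P.L) ≤ δ K₀ / 2 := by
    rw [div_le_div_iff₀ (by positivity) (by norm_num : (0 : ℝ) < 2)]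
    nlinarith
  have hexp0 : Real.exp (-(δ K₀ * ((HiggsLattice.Site.tdist x x' : ℝ) / (P.L : ℝ) ^ 1)))
      ≤ Real.exp (-(δ K₀ / (2 * P.L) * ((HiggsLattice.Site.tdist x x' : ℝ) / (P.L : ℝ) ^ 0))) := by
    apply exp_le_exp_of_le
    rw [pow_one, pow_zero, div_one]
    have h0 : 0 ≤ δ K₀ * ((HiggsLattice.Site.tdist x x' : ℝ) / P.L) := by positivity
    calc δ K₀ / (2 * P.L) * (HiggsLattice.Site.tdist x x' : ℝ) = (1 / 2) * (δ K₀ * ((HiggsLattice.Site.tdist x x' : ℝ) / P.L)) := by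
          ring
      _ ≤ δ K₀ * ((HiggsLattice.Site.tdist x x' : ℝ) / P.L) := by linarith
  have hexpj : Real.exp (-(δ K₀ / 2 * ((HiggsLattice.Site.tdist x x' : ℝ) / (P.L : ℝ) ^ j)))
      ≤ Real.exp (-(δ K₀ / (2 * P.L) * ((HiggsLattice.Site.tdist x x' : ℝ) / (P.L : ℝ) ^ j))) :=
    exp_rate_mono hrate (by positivity)
  have hmj : 0 < P.mesh j := P.mesh_pos j
  rcases Nat.eq_zero_or_pos j with rfl | hj1
  · -- the piece `G^η_{(0)} = G^ε_1`: (I.2.25) at level `1` on the dipole source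
    refine (mixed_piece_zero_le C A msq (k := k) hc₀'.le hδK.le (hDl le_rfl hk1) μ ν x x').trans ?_
    rw [pow_zero] at hexp0 ⊢
    exact mul_le_mul (mul_le_mul_of_nonneg_right (le_cstMix_zero hc₀'.le hc₁) (by positivity)) hexp0
      (Real.exp_pos _).le (by positivity)
  · by_cases hjk : j < k
    · refine (mixed_piece_pos_le C A msq ha hL1 hj1 hjk (hjk.le.trans hkK) hc₀'.le hc₁ hδK (hDl hj1 hjk.le)
        (hCl hj1 hjk) μ ν x x').trans ?_
      exact mul_le_mul (mul_le_mul_of_nonneg_right (le_cstMix_pos hc₀'.le hc₁) (by positivity)) hexpj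
        (Real.exp_pos _).le (by positivity)
    · rw [mixedTerm_eq_zero_of_le C A msq hj1 (not_lt.mp hjk)]
      positivity

end Main

end Literature.MathematicalPhysics.QuantumFieldTheory.Balaban1983to89.B3Ineq210MixedRegularTorus

end
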